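import Literature.Geometry.Kaehler.SiegelTorusThetaCharacteristicAction
import HarnessLib

/-!
# The permutations of theta characteristics form an ACTION of `Γ_g = Sp_{2g}(ℤ)`: the cocycle identity
# of the shift `(diag(cdᵗ); diag(abᵗ))` modulo `2` and the homomorphism `Γ_g → 𝔖((ℤ/2)^{2g})`

Layer `Literature/Geometry/Kaehler`, namespace `Literature.Geometry.Kaehler.ComplexTorus` (lane
`lit-hodgefound`, Layer A4, theta-divisor row A4-17; prover seat `lit-hodgefound-p23`, row «A4-17(u)»).
Sequel of `SiegelTorusThetaCharacteristicAction.lean` (GSM's permutation `symplecticCharPerm hM` of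
`(ℤ/2)^{2g}`, `p ↦ (d −c; −b a)p + (diag(cdᵗ); diag(abᵗ))`, for ONE `M = (a b; c d) ∈ Sp_{2g}(ℤ)`;
`charActionMatrix M = (d −c; −b a) = ᵗM⁻¹`, `charActionShift M`).

Source followed (held text, read at the quoted chunk): S. Grushevsky, R. Salvati Manni, *Gradients of odd
theta functions*, J. reine angew. Math. 573 (2004) [held `paper:arxiv-math_0310085` p0003 L77–L87]:
"The group `Γ_g` ACTS on the set of characteristics as follows:
`γ(ε;δ) := (d −c; −b a)(ε;δ) + (diag(cdᵗ); diag(abᵗ))`, where the resulting characteristics is taken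
modulo 2." — i.e. `M ↦ γ_M` is a group homomorphism `Γ_g → 𝔖((ℤ/2)^{2g})`: `γ_{MM'} = γ_M ∘ γ_{M'}`,
`γ_1 = id`. The linear parts compose exactly (`ᵗ(MM')⁻¹ = ᵗM⁻¹ ᵗM'⁻¹`); the shift satisfies the COCYCLE
identity `c(MM') ≡ ᵗM⁻¹ c(M') + c(M) (mod 2)`, whose proof is the parity lemma of Lange's proof of
Lemma 3.3.1, `ᵗℓSℓ ≡ ᵗ(S)₀ℓ (mod 2)` for symmetric integral `S` (the tree's
`even_dotProduct_mulVec_sub_diag_dotProduct`), applied to the symmetric matrices `a'ᵗb'`, `c'ᵗd'` of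
`M' ∈ Sp_{2g}(ℤ)`, together with `a'ᵗd' − b'ᵗc' = 1`.

What is here. ONE definition with body (the homomorphism `symplecticCharAction`) and theorems; no named
fact, net debt `0`.

* `charActionMatrix_mul` (`ᵗ(MM')⁻¹ = ᵗM⁻¹ · ᵗM'⁻¹`), `charActionMatrix_one`, `charActionShift_one`.
* `even_diag_mul_mul_transpose_sub` (`(ASᵗA)ᵢᵢ ≡ (A(S)₀)ᵢ mod 2` for symmetric `S`),
  `diag_blocks_mul` (the diagonal of `(ca' + dc')ᵗ(cb' + dd')` given `a'ᵗd' − b'ᵗc' = 1`),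
  **`even_charActionShift_mul_sub`** (the cocycle identity over `ℤ`, componentwise modulo `2`),
  `charActionShift_mul_modTwo`.
* **`symplecticCharPerm_mul_apply`** / **`symplecticCharPerm_mul`** (`γ_{MM'} = γ_M ∘ γ_{M'}`),
  **`symplecticCharPerm_one`**, and the homomorphism **`symplecticCharAction : Sp_{2g}(ℤ) →* 𝔖((ℤ/2)^{2g})`**
  with `symplecticCharAction_apply`; `symplecticCharPerm_inv_apply`, `symplecticCharPerm_apply_inv`,
  `symplecticCharPerm_symm_eq` (the inverse permutation is `γ_{M⁻¹}`).

Not here: transitivity on even / odd characteristics, the kernel `Γ_g(2)`.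

## References

* [GrushevskySalvatiManni2004Gradients] S. Grushevsky, R. Salvati Manni, *Gradients of odd theta
  functions*, J. reine angew. Math. 573 (2004), 45–59 (arXiv:math/0310085), p. 3 of the held text
  (L77–L87, L107–L108).
* [Lange2023AbelianVarietiesComplex] H. Lange, *Abelian Varieties over the Complex Numbers* (2023),
  §3.1.2 Lemma 3.1.3, §3.1.3 Prop. 3.1.7, §3.3.1 Lemma 3.3.1 and its proof (the parity lemma).
* [GrushevskySalvatiManni2008] S. Grushevsky, R. Salvati Manni, *Jacobians with a vanishing theta-null in
  genus 4*, Israel J. Math. 164 (2008), Definition 5 (p0004 of the held text).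
* [MumfordTata1] D. Mumford, *Tata Lectures on Theta I*, Ch. II §5.
-/

noncomputable section

open scoped Manifold Topology
open scoped Real
open Set Function Complex Matrix Filter
open Literature.Analysis.SpecialFunctions Literature.Analysis.Complex

namespace Literature.Geometry.Kaehler

namespace ComplexTorus

open Literature.NumberTheory.Automorphic (siegelUpperHalfSpace)
open Literature.NumberTheory.ModularForms.SiegelUpperHalfSpace (moeb denom)

variable {n : ℕ}

/-! ### §1 Blocks of a product; the linear parts compose -/

section Linear

variable {M M' : Matrix (Fin n ⊕ Fin n) (Fin n ⊕ Fin n) ℤ}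

/-- `(MM')₁₁ = αα' + βγ'`. [folklore] -/
private theorem toBlocks₁₁_mul (M M' : Matrix (Fin n ⊕ Fin n) (Fin n ⊕ Fin n) ℤ) :
    (M * M').toBlocks₁₁ = M.toBlocks₁₁ * M'.toBlocks₁₁ + M.toBlocks₁₂ * M'.toBlocks₂₁ := by
  ext i j
  simp [Matrix.toBlocks₁₁, Matrix.toBlocks₁₂, Matrix.toBlocks₂₁, Matrix.mul_apply, Fintype.sum_sum_type]

/-- `(MM')₁₂ = αβ' + βδ'`. [folklore] -/
private theorem toBlocks₁₂_mul (M M' : Matrix (Fin n ⊕ Fin n) (Fin n ⊕ Fin n) ℤ) :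
    (M * M').toBlocks₁₂ = M.toBlocks₁₁ * M'.toBlocks₁₂ + M.toBlocks₁₂ * M'.toBlocks₂₂ := by
  ext i j
  simp [Matrix.toBlocks₁₁, Matrix.toBlocks₁₂, Matrix.toBlocks₂₂, Matrix.mul_apply, Fintype.sum_sum_type]

/-- `(MM')₂₁ = γα' + δγ'`. [folklore] -/
private theorem toBlocks₂₁_mul (M M' : Matrix (Fin n ⊕ Fin n) (Fin n ⊕ Fin n) ℤ) :
    (M * M').toBlocks₂₁ = M.toBlocks₂₁ * M'.toBlocks₁₁ + M.toBlocks₂₂ * M'.toBlocks₂₁ := by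
  ext i j
  simp [Matrix.toBlocks₁₁, Matrix.toBlocks₂₁, Matrix.toBlocks₂₂, Matrix.mul_apply, Fintype.sum_sum_type]

/-- `(MM')₂₂ = γβ' + δδ'`. [folklore] -/
private theorem toBlocks₂₂_mul (M M' : Matrix (Fin n ⊕ Fin n) (Fin n ⊕ Fin n) ℤ) :
    (M * M').toBlocks₂₂ = M.toBlocks₂₁ * M'.toBlocks₁₂ + M.toBlocks₂₂ * M'.toBlocks₂₂ := by
  ext i j
  simp [Matrix.toBlocks₁₂, Matrix.toBlocks₂₁, Matrix.toBlocks₂₂, Matrix.mul_apply, Fintype.sum_sum_type]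

/-- **The linear parts compose**: `ᵗ(MM')⁻¹ = ᵗM⁻¹ · ᵗM'⁻¹`, i.e.
`charActionMatrix (M M') = charActionMatrix M · charActionMatrix M'` for `M, M' ∈ Sp_{2g}(ℤ)` (both sides
are the inverse of `ᵗ(MM') = ᵗM' ᵗM`). [cite: Lange2023AbelianVarietiesComplex, §3.1.3 proof of Prop. 3.1.7 (p0161)]
[cite: GrushevskySalvatiManni2004Gradients, p0003 L77–L84 of the held text] -/
theorem charActionMatrix_mul (hM : M ∈ Matrix.symplecticGroup (Fin n) ℤ)
    (hM' : M' ∈ Matrix.symplecticGroup (Fin n) ℤ) :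
    charActionMatrix (M * M') = charActionMatrix M * charActionMatrix M' := by
  have h1 : charActionMatrix (M * M') * (M * M')ᵀ = 1 :=
    charActionMatrix_mul_transpose (mul_mem hM hM')
  have h2 : charActionMatrix M * charActionMatrix M' * (M * M')ᵀ = 1 := by
    rw [Matrix.transpose_mul, Matrix.mul_assoc, ← Matrix.mul_assoc (charActionMatrix M'),
      charActionMatrix_mul_transpose hM', Matrix.one_mul, charActionMatrix_mul_transpose hM]
  have h1' : (M * M')ᵀ * charActionMatrix (M * M') = 1 := mul_eq_one_comm.1 h1
  calc charActionMatrix (M * M')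
      = charActionMatrix M * charActionMatrix M' * (M * M')ᵀ * charActionMatrix (M * M') := by
        rw [h2, Matrix.one_mul]
    _ = charActionMatrix M * charActionMatrix M' * ((M * M')ᵀ * charActionMatrix (M * M')) := by
        rw [Matrix.mul_assoc (charActionMatrix M * charActionMatrix M')]
    _ = charActionMatrix M * charActionMatrix M' := by rw [h1', Matrix.mul_one]

/-- `charActionMatrix 1 = 1`. [cite: GrushevskySalvatiManni2004Gradients, p0003 L77–L84 of the held text] -/
theorem charActionMatrix_one : charActionMatrix (1 : Matrix (Fin n ⊕ Fin n) (Fin n ⊕ Fin n) ℤ) = 1 := by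
  have h := charActionMatrix_mul_transpose (one_mem (Matrix.symplecticGroup (Fin n) ℤ))
  rwa [Matrix.transpose_one, Matrix.mul_one] at h

/-- `charActionShift 1 = 0` (`1` has off-diagonal blocks `0`). [cite: GrushevskySalvatiManni2004Gradients, p0003 L77–L84 of the held text] -/
theorem charActionShift_one : charActionShift (1 : Matrix (Fin n ⊕ Fin n) (Fin n ⊕ Fin n) ℤ) = 0 := by
  have h₂₁ : (1 : Matrix (Fin n ⊕ Fin n) (Fin n ⊕ Fin n) ℤ).toBlocks₂₁ = 0 := by
    ext i j
    simp [Matrix.toBlocks₂₁]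
  have h₁₂ : (1 : Matrix (Fin n ⊕ Fin n) (Fin n ⊕ Fin n) ℤ).toBlocks₁₂ = 0 := by
    ext i j
    simp [Matrix.toBlocks₁₂]
  rw [charActionShift, h₂₁, h₁₂, Matrix.zero_mul, Matrix.transpose_zero, Matrix.mul_zero, Matrix.diag_zero]
  funext s
  rcases s with i | i <;> rfl

end Linear

/-! ### §2 The cocycle identity of the shift modulo `2` -/

section Cocycle

/-- **`(ASᵗA)ᵢᵢ ≡ (A·(S)₀)ᵢ (mod 2)` for a symmetric integral `S`** — the parity lemma
`ᵗℓSℓ ≡ ᵗ(S)₀ℓ (mod 2)` of the proof of Lemma 3.3.1 applied to the rows `ℓ = Aᵢ`.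
[cite: Lange2023AbelianVarietiesComplex, §3.3.1 proof of Lemma 3.3.1 (p0170)] -/
theorem even_diag_mul_mul_transpose_sub (A S : Matrix (Fin n) (Fin n) ℤ) (hS : S.IsSymm) (i : Fin n) :
    Even (Matrix.diag (A * S * Aᵀ) i - (A *ᵥ Matrix.diag S) i) := by
  have h1 : Matrix.diag (A * S * Aᵀ) i = A i ⬝ᵥ S *ᵥ A i := by
    simp only [Matrix.diag_apply, Matrix.mul_apply, Matrix.transpose_apply, dotProduct, Matrix.mulVec,
      Finset.sum_mul, Finset.mul_sum]
    rw [Finset.sum_comm]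
    exact Finset.sum_congr rfl fun j _ ↦ Finset.sum_congr rfl fun k _ ↦ by ring
  have h2 : (A *ᵥ Matrix.diag S) i = Matrix.diag S ⬝ᵥ A i := by
    simp only [Matrix.mulVec, dotProduct]
    exact Finset.sum_congr rfl fun j _ ↦ mul_comm _ _
  rw [h1, h2]
  exact even_dotProduct_mulVec_sub_diag_dotProduct hS (A i)

/-- **The diagonal of a lower block of a product**: for square integral matrices with
`a'ᵗd' − b'ᵗc' = 1`,
`diag((ca' + dc')ᵗ(cb' + dd')) = diag(c(a'ᵗb')ᵗc) + diag(d(c'ᵗd')ᵗd) + diag(cᵗd) + 2·diag(c(b'ᵗc')ᵗd)`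
(expand, use `a'ᵗd' = 1 + b'ᵗc'`, and `diag(X) = diag(ᵗX)` on the cross term `dc'ᵗb'ᵗc`).
[cite: Lange2023AbelianVarietiesComplex, §3.1.2 Lemma 3.1.3 (p0159)] -/
theorem diag_blocks_mul (α' β' γ' δ' γ δ : Matrix (Fin n) (Fin n) ℤ) (h : α' * δ'ᵀ - β' * γ'ᵀ = 1)
    (i : Fin n) :
    Matrix.diag ((γ * α' + δ * γ') * (γ * β' + δ * δ')ᵀ) i =
      Matrix.diag (γ * (α' * β'ᵀ) * γᵀ) i + Matrix.diag (δ * (γ' * δ'ᵀ) * δᵀ) i + Matrix.diag (γ * δᵀ) i +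
        2 * Matrix.diag (γ * (β' * γ'ᵀ) * δᵀ) i := by
  have hαδ : α' * δ'ᵀ = 1 + β' * γ'ᵀ := by
    rw [← h]
    abel
  have hexp : (γ * α' + δ * γ') * (γ * β' + δ * δ')ᵀ =
      γ * (α' * β'ᵀ) * γᵀ + γ * (α' * δ'ᵀ) * δᵀ + δ * γ' * β'ᵀ * γᵀ + δ * (γ' * δ'ᵀ) * δᵀ := by
    rw [Matrix.transpose_add, Matrix.transpose_mul, Matrix.transpose_mul]
    noncomm_ring
  have hT : Matrix.diag (δ * γ' * β'ᵀ * γᵀ) = Matrix.diag (γ * (β' * γ'ᵀ) * δᵀ) := by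
    rw [← Matrix.diag_transpose (δ * γ' * β'ᵀ * γᵀ)]
    congr 1
    simp only [Matrix.transpose_mul, Matrix.transpose_transpose, Matrix.mul_assoc]
  rw [hexp, hαδ]
  simp only [Matrix.mul_add, Matrix.add_mul, Matrix.mul_one, Matrix.diag_add, Pi.add_apply]
  rw [show Matrix.diag (δ * γ' * β'ᵀ * γᵀ) i = Matrix.diag (γ * (β' * γ'ᵀ) * δᵀ) i from
    congrFun hT i]
  ring

variable {M M' : Matrix (Fin n ⊕ Fin n) (Fin n ⊕ Fin n) ℤ}

/-- **The cocycle identity of the shift, over `ℤ` and componentwise modulo `2`**: for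
`M, M' ∈ Sp_{2g}(ℤ)`, every component of `c(MM') − (ᵗM⁻¹ c(M') + c(M))` is even, where
`c(M) = (diag(cdᵗ); diag(abᵗ))` and `ᵗM⁻¹ = (d −c; −b a)` — this is what makes `M ↦ γ_M` an action.
[cite: GrushevskySalvatiManni2004Gradients, p0003 L77–L87 of the held text]
[cite: Lange2023AbelianVarietiesComplex, §3.3.1 proof of Lemma 3.3.1 (p0170)] -/
theorem even_charActionShift_mul_sub (hM : M ∈ Matrix.symplecticGroup (Fin n) ℤ)
    (hM' : M' ∈ Matrix.symplecticGroup (Fin n) ℤ) (s : Fin n ⊕ Fin n) :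
    Even (charActionShift (M * M') s - (charActionMatrix M *ᵥ charActionShift M' + charActionShift M) s) := by
  have _hMu := hM
  obtain ⟨h1', h2', h3'⟩ := blocks_rel_transpose hM'
  have hS₁ : (M'.toBlocks₁₁ * M'.toBlocks₁₂ᵀ).IsSymm := by
    unfold Matrix.IsSymm
    rw [Matrix.transpose_mul, Matrix.transpose_transpose]
    exact h1'.symm
  have hS₂ : (M'.toBlocks₂₁ * M'.toBlocks₂₂ᵀ).IsSymm := by
    unfold Matrix.IsSymm
    rw [Matrix.transpose_mul, Matrix.transpose_transpose]
    exact h2'.symm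
  rw [charActionShift, charActionShift, charActionShift, charActionMatrix, Matrix.fromBlocks_mulVec,
    Sum.elim_comp_inl, Sum.elim_comp_inr]
  rcases s with i | i
  · simp only [Pi.add_apply, Sum.elim_inl, Matrix.neg_mulVec, Pi.neg_apply]
    rw [toBlocks₂₁_mul, toBlocks₂₂_mul,
      diag_blocks_mul M'.toBlocks₁₁ M'.toBlocks₁₂ M'.toBlocks₂₁ M'.toBlocks₂₂ M.toBlocks₂₁ M.toBlocks₂₂ h3' i]
    obtain ⟨a, ha⟩ := even_diag_mul_mul_transpose_sub M.toBlocks₂₁ _ hS₁ i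
    obtain ⟨b, hb⟩ := even_diag_mul_mul_transpose_sub M.toBlocks₂₂ _ hS₂ i
    exact ⟨a + b + Matrix.diag (M.toBlocks₂₁ * (M'.toBlocks₁₂ * M'.toBlocks₂₁ᵀ) * M.toBlocks₂₂ᵀ) i +
      (M.toBlocks₂₁ *ᵥ Matrix.diag (M'.toBlocks₁₁ * M'.toBlocks₁₂ᵀ)) i, by linarith⟩
  · simp only [Pi.add_apply, Sum.elim_inr, Matrix.neg_mulVec, Pi.neg_apply]
    rw [toBlocks₁₁_mul, toBlocks₁₂_mul,
      diag_blocks_mul M'.toBlocks₁₁ M'.toBlocks₁₂ M'.toBlocks₂₁ M'.toBlocks₂₂ M.toBlocks₁₁ M.toBlocks₁₂ h3' i]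
    obtain ⟨a, ha⟩ := even_diag_mul_mul_transpose_sub M.toBlocks₁₁ _ hS₁ i
    obtain ⟨b, hb⟩ := even_diag_mul_mul_transpose_sub M.toBlocks₁₂ _ hS₂ i
    exact ⟨a + b + Matrix.diag (M.toBlocks₁₁ * (M'.toBlocks₁₂ * M'.toBlocks₂₁ᵀ) * M.toBlocks₁₂ᵀ) i +
      (M.toBlocks₁₂ *ᵥ Matrix.diag (M'.toBlocks₂₁ * M'.toBlocks₂₂ᵀ)) i, by linarith⟩

/-- **The cocycle identity modulo `2`**: `c̄(MM') = \overline{ᵗM⁻¹ c(M') + c(M)}` in `(ℤ/2)^{2g}`.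
[cite: GrushevskySalvatiManni2004Gradients, p0003 L77–L87 of the held text] -/
theorem charActionShift_mul_modTwo (hM : M ∈ Matrix.symplecticGroup (Fin n) ℤ)
    (hM' : M' ∈ Matrix.symplecticGroup (Fin n) ℤ) :
    (fun s ↦ ((charActionShift (M * M') s : ℤ) : ZMod 2)) =
      fun s ↦ (((charActionMatrix M *ᵥ charActionShift M' + charActionShift M) s : ℤ) : ZMod 2) := by
  funext s
  obtain ⟨r, hr⟩ := even_charActionShift_mul_sub hM hM' s
  have h : charActionShift (M * M') s =
      (charActionMatrix M *ᵥ charActionShift M' + charActionShift M) s + 2 * r := by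
    linarith
  rw [h, Int.cast_add, Int.cast_mul, Int.cast_ofNat, show (2 : ZMod 2) = 0 from by decide, zero_mul,
    add_zero]

end Cocycle

/-! ### §3 `M ↦ γ_M` is a homomorphism `Γ_g → 𝔖((ℤ/2)^{2g})` -/

section Hom

variable {M M' : Matrix (Fin n ⊕ Fin n) (Fin n ⊕ Fin n) ℤ}

/-- **`γ_{MM'}(p) = γ_M(γ_{M'}(p))`** for `M, M' ∈ Sp_{2g}(ℤ)` and every characteristic `p ∈ (ℤ/2)^{2g}`:
the linear parts compose and the shifts satisfy the cocycle identity modulo `2`.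
[cite: GrushevskySalvatiManni2004Gradients, p0003 L77–L87 ("The group `Γ_g` acts on the set of characteristics") of the held text] -/
theorem symplecticCharPerm_mul_apply (hM : M ∈ Matrix.symplecticGroup (Fin n) ℤ)
    (hM' : M' ∈ Matrix.symplecticGroup (Fin n) ℤ) (p : Fin n ⊕ Fin n → ZMod 2) :
    symplecticCharPerm (mul_mem hM hM') p = symplecticCharPerm hM (symplecticCharPerm hM' p) := by
  obtain ⟨v, rfl⟩ : ∃ v : Fin n ⊕ Fin n → ℤ, p = fun s ↦ (v s : ZMod 2) :=
    ⟨fun s ↦ (((p s).val : ℕ) : ℤ), by funext s; simp⟩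
  rw [symplecticCharPerm_intCast, symplecticCharPerm_intCast hM', symplecticCharPerm_intCast hM,
    charActionMatrix_mul hM hM']
  funext s
  have hc := congrFun (charActionShift_mul_modTwo hM hM') s
  simp only [Pi.add_apply, Int.cast_add, ← Matrix.mulVec_mulVec, Matrix.mulVec_add, hc]
  ring

/-- **`γ_{MM'} = γ_M ∘ γ_{M'}`** as permutations of `(ℤ/2)^{2g}`.
[cite: GrushevskySalvatiManni2004Gradients, p0003 L77–L87 of the held text] -/
theorem symplecticCharPerm_mul (hM : M ∈ Matrix.symplecticGroup (Fin n) ℤ)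
    (hM' : M' ∈ Matrix.symplecticGroup (Fin n) ℤ) :
    symplecticCharPerm (mul_mem hM hM') = (symplecticCharPerm hM').trans (symplecticCharPerm hM) :=
  Equiv.ext fun p ↦ symplecticCharPerm_mul_apply hM hM' p

/-- **`γ_1 = id`.** [cite: GrushevskySalvatiManni2004Gradients, p0003 L77–L87 of the held text] -/
theorem symplecticCharPerm_one :
    symplecticCharPerm (one_mem (Matrix.symplecticGroup (Fin n) ℤ)) =
      Equiv.refl (Fin n ⊕ Fin n → ZMod 2) := by
  refine Equiv.ext fun p ↦ ?_
  rw [symplecticCharPerm_apply, charActionMatrix_one, charActionShift_one,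
    Matrix.map_one _ (map_zero _) (map_one _), Matrix.one_mulVec, Equiv.refl_apply]
  funext s
  simp

/-- **"The group `Γ_g` acts on the set of characteristics"**: the homomorphism
`Sp_{2g}(ℤ) → 𝔖((ℤ/2)^{2g})`, `M ↦ γ_M`. [cite: GrushevskySalvatiManni2004Gradients, p0003 L77–L87 and L107–L108 of the held text] -/
def symplecticCharAction : Matrix.symplecticGroup (Fin n) ℤ →* Equiv.Perm (Fin n ⊕ Fin n → ZMod 2) where
  toFun M := symplecticCharPerm M.2
  map_one' := symplecticCharPerm_one
  map_mul' M M' := Equiv.ext fun p ↦ symplecticCharPerm_mul_apply M.2 M'.2 p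

/-- Unfolding of `symplecticCharAction`. [cite: GrushevskySalvatiManni2004Gradients, p0003 L77–L87 of the held text] -/
theorem symplecticCharAction_apply (M : Matrix.symplecticGroup (Fin n) ℤ) (p : Fin n ⊕ Fin n → ZMod 2) :
    symplecticCharAction M p = symplecticCharPerm M.2 p :=
  rfl

/-- `γ_{M⁻¹}(γ_M(p)) = p`. [cite: GrushevskySalvatiManni2004Gradients, p0003 L77–L87 of the held text] -/
theorem symplecticCharPerm_inv_apply (M : Matrix.symplecticGroup (Fin n) ℤ) (p : Fin n ⊕ Fin n → ZMod 2) :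
    symplecticCharPerm (M⁻¹).2 (symplecticCharPerm M.2 p) = p := by
  have h := symplecticCharPerm_mul_apply (M⁻¹).2 M.2 p
  have h1 : symplecticCharPerm (mul_mem (M⁻¹).2 M.2) =
      symplecticCharPerm (one_mem (Matrix.symplecticGroup (Fin n) ℤ)) := by
    congr 1
    exact congrArg Subtype.val (inv_mul_cancel M)
  rw [h1, symplecticCharPerm_one, Equiv.refl_apply] at h
  exact h.symm

/-- `γ_M(γ_{M⁻¹}(q)) = q`. [cite: GrushevskySalvatiManni2004Gradients, p0003 L77–L87 of the held text] -/
theorem symplecticCharPerm_apply_inv (M : Matrix.symplecticGroup (Fin n) ℤ) (q : Fin n ⊕ Fin n → ZMod 2) :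
    symplecticCharPerm M.2 (symplecticCharPerm (M⁻¹).2 q) = q := by
  have h := symplecticCharPerm_mul_apply M.2 (M⁻¹).2 q
  have h1 : symplecticCharPerm (mul_mem M.2 (M⁻¹).2) =
      symplecticCharPerm (one_mem (Matrix.symplecticGroup (Fin n) ℤ)) := by
    congr 1
    exact congrArg Subtype.val (mul_inv_cancel M)
  rw [h1, symplecticCharPerm_one, Equiv.refl_apply] at h
  exact h.symm

/-- **The inverse permutation is `γ_{M⁻¹}`**: `(γ_M)⁻¹ = γ_{M⁻¹}` for `M ∈ Sp_{2g}(ℤ)`.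
[cite: GrushevskySalvatiManni2004Gradients, p0003 L77–L87 of the held text] -/
theorem symplecticCharPerm_symm_eq (M : Matrix.symplecticGroup (Fin n) ℤ) :
    (symplecticCharPerm M.2).symm = symplecticCharPerm (M⁻¹).2 := by
  refine Equiv.ext fun q ↦ ?_
  rw [Equiv.symm_apply_eq]
  exact (symplecticCharPerm_apply_inv M q).symm

end Hom

end ComplexTorus

end Literature.Geometry.Kaehler

end
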